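import Summits.FinalStateConjecture.FinalStateConjecture.Theorems.InertialRecession.Negative.ExpandingChargeWitness

/-!
# Negative knowledge for the crux `InertialRecession` (item stmt-FinalStateConjecture-10166), X:
# `stub_expandingChargeKinematics` without ADDITIVITY — the drifting binary (definitions and kinematics)

Refuter file (D-0016 negative lane, `--supports stmt-FinalStateConjecture-10166`), drefute seat gen 4, line
`old-light-leaves-the-cone`, stub S4. No Theses decl is asserted. This file builds the model used by
`ExpandingChargeAdditivity.lean` (next file) to show that the ADDITIVITY clause of S4 is load-bearing:

* §1 the second axis `e₁`, `‖a•e₀ + b•e₁‖² = a² + b²`; the separation profile `d(t) = √(1 + √(1 + t²)) ≍ √t`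
  (`sepA`: smooth, `≥ 1`, `≥ √t`, `d² ≤ 2 + t`, `|d'| ≤ 1/(2d) → 0`); the Lorentz factor `(√(1 − u²))⁻¹` is `1`-Lipschitz
  and the momentum `u(√(1 − u²))⁻¹` is `2`-Lipschitz on `[−1/4, 1/4]` (pure algebra);
* §2 the binary `binaryCentre i = axisCentre + (i − 1/2) d • e₁` (common drift = the witness world-line of
  `ExpandingChargeWitness.lean`, separation `d` along `e₁`), its velocities `binaryVel`, and the abstract charge
  `binaryCharge` = the drift's charge `kinCharge` on windows containing EXACTLY ONE hole, `0` on windows containing both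
  or none; kinematic clauses: smooth, in the cone `(3/4)²t`, speeds `≤ 1/2`, exact slaving, separation `d → ∞`.
-/

set_option linter.dupNamespace false

noncomputable section

namespace Summit.FinalStateConjecture.FinalStateConjecture.Theorems.InertialRecession.Negative

open Filter Set
open scoped Topology
open Literature.Geometry.Lorentzian

/-! ## §1 Axes, the separation profile `d`, and two Lipschitz bounds for the Lorentz factor -/

/-- The second spatial axis of `E3`. -/
def axis1 : E3 := EuclideanSpace.single (1 : Fin 3) (1 : ℝ)

/-- `‖e₁‖ = 1`. [folklore] -/
@[simp] lemma norm_axis1 : ‖axis1‖ = 1 := by simp [axis1]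

/-- The `0`-th coordinate of `e₁` is `0`. [folklore] -/
@[simp] lemma axis1_apply_zero : axis1 0 = 0 := by simp [axis1]

/-- The `1`-st coordinate of `e₁` is `1`. [folklore] -/
@[simp] lemma axis1_apply_one : axis1 1 = 1 := by simp [axis1]

/-- The `2`-nd coordinate of `e₁` is `0`. [folklore] -/
@[simp] lemma axis1_apply_two : axis1 2 = 0 := by simp [axis1]

/-- The `1`-st coordinate of `e₀` is `0`. [folklore] -/
@[simp] lemma axis0_apply_one : axis0 1 = 0 := by simp [axis0]

/-- The `2`-nd coordinate of `e₀` is `0`. [folklore] -/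
@[simp] lemma axis0_apply_two : axis0 2 = 0 := by simp [axis0]

/-- `‖a • e₀ + b • e₁‖² = a² + b²`. [folklore] -/
lemma norm_sq_axis01 (a b : ℝ) : ‖a • axis0 + b • axis1‖ ^ 2 = a ^ 2 + b ^ 2 := by
  rw [EuclideanSpace.norm_sq_eq, Fin.sum_univ_three]
  simp

/-- The separation profile `d(t) = √(1 + √(1 + t²)) ≍ √t` of the binary. -/
def sepA (t : ℝ) : ℝ := Real.sqrt (1 + Real.sqrt (1 + t ^ 2))

/-- Its derivative `d'(t) = (2t / (2√(1+t²))) / (2 d(t))`. -/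
def sepAD1 (t : ℝ) : ℝ := (2 * t / (2 * Real.sqrt (1 + t ^ 2))) / (2 * sepA t)

/-- `0 < 1 + √(1 + t²)`. [folklore] -/
lemma one_add_sqrt_pos (t : ℝ) : 0 < 1 + Real.sqrt (1 + t ^ 2) := by positivity

/-- `d > 0`. [folklore] -/
lemma sepA_pos (t : ℝ) : 0 < sepA t := Real.sqrt_pos.mpr (one_add_sqrt_pos t)

/-- `d² = 1 + √(1 + t²)`. [folklore] -/
lemma sepA_sq (t : ℝ) : sepA t ^ 2 = 1 + Real.sqrt (1 + t ^ 2) := Real.sq_sqrt (one_add_sqrt_pos t).le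

/-- `1 ≤ d`. [folklore] -/
lemma one_le_sepA (t : ℝ) : 1 ≤ sepA t := by
  rw [sepA, Real.le_sqrt (by norm_num) (one_add_sqrt_pos t).le]
  have := Real.sqrt_nonneg (1 + t ^ 2)
  linarith

/-- `d² ≤ 2 + t` for `t ≥ 0`. [folklore] -/
lemma sepA_sq_le {t : ℝ} (ht : 0 ≤ t) : sepA t ^ 2 ≤ 2 + t := by
  rw [sepA_sq]
  have : Real.sqrt (1 + t ^ 2) ≤ 1 + t := by
    rw [Real.sqrt_le_left (by linarith)]
    nlinarith
  linarith

/-- `√t ≤ d` for `t ≥ 0` (so `d → ∞`). [folklore] -/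
lemma sqrt_le_sepA {t : ℝ} (ht : 0 ≤ t) : Real.sqrt t ≤ sepA t := by
  unfold sepA
  apply Real.sqrt_le_sqrt
  have : t ≤ Real.sqrt (1 + t ^ 2) := by
    rw [Real.le_sqrt ht (by positivity)]
    nlinarith
  linarith

/-- `d → ∞`. [folklore] -/
lemma tendsto_sepA_atTop : Tendsto sepA atTop atTop := by
  refine tendsto_atTop_atTop.mpr fun b ↦ ⟨max (b ^ 2) 0, fun t ht ↦ ?_⟩
  have ht0 : 0 ≤ t := le_trans (le_max_right _ _) ht
  calc b ≤ |b| := le_abs_self b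
    _ = Real.sqrt (b ^ 2) := (Real.sqrt_sq_eq_abs b).symm
    _ ≤ Real.sqrt t := Real.sqrt_le_sqrt (le_trans (le_max_left _ _) ht)
    _ ≤ sepA t := sqrt_le_sepA ht0

/-- `d` is smooth. [folklore] -/
lemma contDiff_sepA : ContDiff ℝ ((⊤ : ℕ∞) : WithTop ℕ∞) sepA := by
  unfold sepA
  refine ContDiff.sqrt ?_ fun t ↦ (one_add_sqrt_pos t).ne'
  refine contDiff_const.add (ContDiff.sqrt ?_ fun t ↦ (by positivity : (0 : ℝ) < 1 + t ^ 2).ne')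
  exact contDiff_const.add (contDiff_id.pow 2)

/-- `d' ` is the derivative of `d`. [folklore] -/
lemma hasDerivAt_sepA (t : ℝ) : HasDerivAt sepA (sepAD1 t) t := by
  have h1 : HasDerivAt (fun t : ℝ ↦ 1 + t ^ 2) (2 * t) t := by
    simpa using ((hasDerivAt_pow 2 t).const_add 1)
  have h2 : HasDerivAt (fun t : ℝ ↦ Real.sqrt (1 + t ^ 2)) (2 * t / (2 * Real.sqrt (1 + t ^ 2))) t :=
    h1.sqrt (by positivity : (0 : ℝ) < 1 + t ^ 2).ne'
  exact (h2.const_add 1).sqrt (one_add_sqrt_pos t).ne'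

/-- `deriv d = d'`. [folklore] -/
lemma deriv_sepA (t : ℝ) : deriv sepA t = sepAD1 t := (hasDerivAt_sepA t).deriv

/-- `|d'| ≤ 1/(2d)`. [folklore] -/
lemma abs_sepAD1_le (t : ℝ) : |sepAD1 t| ≤ 1 / (2 * sepA t) := by
  have hs := sepA_pos t
  have hw : 0 < Real.sqrt (1 + t ^ 2) := Real.sqrt_pos.mpr (by positivity)
  have hnum : |2 * t / (2 * Real.sqrt (1 + t ^ 2))| ≤ 1 := by
    rw [abs_div, abs_of_pos (by positivity : (0 : ℝ) < 2 * Real.sqrt (1 + t ^ 2)),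
      div_le_one (by positivity), abs_mul, abs_of_pos (by norm_num : (0 : ℝ) < 2)]
    have : |t| ≤ Real.sqrt (1 + t ^ 2) := by
      rw [← Real.sqrt_sq_eq_abs]
      exact Real.sqrt_le_sqrt (by nlinarith)
    linarith
  rw [sepAD1, abs_div, abs_of_pos (by positivity : (0 : ℝ) < 2 * sepA t)]
  exact div_le_div_of_nonneg_right hnum (by positivity)

/-- `|d'| ≤ 1/2`. [folklore] -/
lemma abs_sepAD1_le_half (t : ℝ) : |sepAD1 t| ≤ 1 / 2 := by
  refine (abs_sepAD1_le t).trans ?_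
  exact one_div_le_one_div_of_le (by norm_num) (by linarith [one_le_sepA t])

/-- `d' → 0`. [folklore] -/
lemma tendsto_sepAD1 : Tendsto sepAD1 atTop (𝓝 0) := by
  have h : Tendsto (fun t ↦ 2 * sepA t) atTop atTop := tendsto_sepA_atTop.const_mul_atTop (by norm_num)
  refine squeeze_zero_norm (fun t ↦ ?_) (tendsto_inv_atTop_zero.comp h)
  rw [Real.norm_eq_abs, Function.comp_apply, ← one_div]
  exact abs_sepAD1_le t

/-- `d'` is continuous. [folklore] -/
lemma continuous_sepAD1 : Continuous sepAD1 := by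
  have h1 : Continuous fun t : ℝ ↦ Real.sqrt (1 + t ^ 2) := (continuous_const.add (continuous_id.pow 2)).sqrt
  have h2 : Continuous fun t : ℝ ↦ 2 * t / (2 * Real.sqrt (1 + t ^ 2)) :=
    (continuous_const.mul continuous_id).div (continuous_const.mul h1) fun t ↦ by positivity
  exact h2.div (continuous_const.mul contDiff_sepA.continuous) fun t ↦ (mul_pos two_pos (sepA_pos t)).ne'

/-- The Lorentz factor `g(u) = (√(1 − u²))⁻¹` is `1`-Lipschitz on `[-1/4, 1/4]`. [folklore] -/
lemma abs_lorentz_sub_le {a b : ℝ} (ha : |a| ≤ 1 / 4) (hb : |b| ≤ 1 / 4) :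
    |(√(1 - a ^ 2))⁻¹ - (√(1 - b ^ 2))⁻¹| ≤ |a - b| := by
  have ha2 : a ^ 2 ≤ 1 / 16 := by
    have := abs_le.mp ha; nlinarith
  have hb2 : b ^ 2 ≤ 1 / 16 := by
    have := abs_le.mp hb; nlinarith
  set s := √(1 - a ^ 2) with hs
  set r := √(1 - b ^ 2) with hr
  have hs2 : s ^ 2 = 1 - a ^ 2 := Real.sq_sqrt (by linarith)
  have hr2 : r ^ 2 = 1 - b ^ 2 := Real.sq_sqrt (by linarith)
  have hs1 : s ≤ 1 := by rw [hs, Real.sqrt_le_one]; nlinarith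
  have hr1 : r ≤ 1 := by rw [hr, Real.sqrt_le_one]; nlinarith
  have hs0 : 0 ≤ s := Real.sqrt_nonneg _
  have hr0 : 0 ≤ r := Real.sqrt_nonneg _
  have hs15 : 15 / 16 ≤ s := by nlinarith
  have hr15 : 15 / 16 ≤ r := by nlinarith
  have hsp : 0 < s := by linarith
  have hrp : 0 < r := by linarith
  have hpos : 0 < s * r * (r + s) := by positivity
  have key : s⁻¹ - r⁻¹ = (a ^ 2 - b ^ 2) / (s * r * (r + s)) := by
    rw [eq_div_iff hpos.ne']
    field_simp
    nlinarith [hs2, hr2]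
  rw [key, abs_div, abs_of_pos hpos, div_le_iff₀ hpos]
  have hden : 3 / 2 ≤ s * r * (r + s) := by nlinarith [mul_le_mul hs15 hr15 (by norm_num) hs0]
  have hnum : |a ^ 2 - b ^ 2| ≤ |a - b| * (1 / 2) := by
    rw [show a ^ 2 - b ^ 2 = (a - b) * (a + b) by ring, abs_mul]
    refine mul_le_mul_of_nonneg_left ?_ (abs_nonneg _)
    calc |a + b| ≤ |a| + |b| := abs_add_le _ _
      _ ≤ 1 / 2 := by linarith
  have := abs_nonneg (a - b)
  nlinarith

/-- The momentum `h(u) = u (√(1 − u²))⁻¹` is `2`-Lipschitz on `[-1/4, 1/4]`. [folklore] -/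
lemma abs_lorentzMomentum_sub_le {a b : ℝ} (ha : |a| ≤ 1 / 4) (hb : |b| ≤ 1 / 4) :
    |(√(1 - a ^ 2))⁻¹ * a - (√(1 - b ^ 2))⁻¹ * b| ≤ 2 * |a - b| := by
  have hb2 : b ^ 2 ≤ 1 / 16 := by
    have := abs_le.mp hb; nlinarith
  have hga : (√(1 - a ^ 2))⁻¹ ≤ 3 / 2 := by
    have ha2 : a ^ 2 ≤ 1 / 16 := by
      have := abs_le.mp ha; nlinarith
    have h14 : (2 / 3 : ℝ) ≤ √(1 - a ^ 2) := by
      rw [Real.le_sqrt (by norm_num) (by linarith)]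
      nlinarith
    calc (√(1 - a ^ 2))⁻¹ ≤ (2 / 3 : ℝ)⁻¹ := by
          exact inv_anti₀ (by norm_num) h14
      _ = 3 / 2 := by norm_num
  have hga0 : 0 ≤ (√(1 - a ^ 2))⁻¹ := inv_nonneg.mpr (Real.sqrt_nonneg _)
  have hsplit : (√(1 - a ^ 2))⁻¹ * a - (√(1 - b ^ 2))⁻¹ * b =
      (√(1 - a ^ 2))⁻¹ * (a - b) + b * ((√(1 - a ^ 2))⁻¹ - (√(1 - b ^ 2))⁻¹) := by ring
  rw [hsplit]
  calc |(√(1 - a ^ 2))⁻¹ * (a - b) + b * ((√(1 - a ^ 2))⁻¹ - (√(1 - b ^ 2))⁻¹)|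
      ≤ |(√(1 - a ^ 2))⁻¹ * (a - b)| + |b * ((√(1 - a ^ 2))⁻¹ - (√(1 - b ^ 2))⁻¹)| := abs_add_le _ _
    _ = (√(1 - a ^ 2))⁻¹ * |a - b| + |b| * |(√(1 - a ^ 2))⁻¹ - (√(1 - b ^ 2))⁻¹| := by
        rw [abs_mul, abs_mul, abs_of_nonneg hga0]
    _ ≤ 3 / 2 * |a - b| + 1 / 4 * |a - b| :=
        add_le_add (mul_le_mul hga le_rfl (abs_nonneg _) (by norm_num))
          (mul_le_mul hb (abs_lorentz_sub_le ha hb) (abs_nonneg _) (by norm_num))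
    _ ≤ 2 * |a - b| := by linarith [abs_nonneg (a - b)]

/-! ## §2 The drifting binary and its abstract charge -/

/-- The binary: common drift `axisCentre` along `e₀`, separation `d(t)` along `e₁` (hole `0` at `−d/2`, hole `1` at
`+d/2`). -/
def binaryCentre (i : Fin 2) (t : ℝ) : E3 := axisCentre t + ((((i : ℕ) : ℝ) - 1 / 2) * sepA t) • axis1

/-- Its velocities. -/
def binaryVel (i : Fin 2) (t : ℝ) : E3 := axisVel t + ((((i : ℕ) : ℝ) - 1 / 2) * sepAD1 t) • axis1

/-- The abstract charge of the binary WITHOUT additivity: the exact kinematic charge of the drift (`kinCharge`, the same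
for both holes up to `o(1)`) on windows containing exactly one hole, and `0` on windows containing both or none. -/
def binaryCharge (t : ℝ) (c : E3) (R : ℝ) (μ : Fin 4) : ℝ :=
  if (‖binaryCentre 0 t - c‖ ≤ R ↔ ‖binaryCentre 1 t - c‖ ≤ R) then 0 else kinCharge t μ

/-- The binary world-lines are smooth. [folklore] -/
lemma contDiff_binaryCentre (i : Fin 2) : ContDiff ℝ ((⊤ : ℕ∞) : WithTop ℕ∞) (binaryCentre i) :=
  contDiff_axisCentre.add ((contDiff_const.mul contDiff_sepA).smul contDiff_const)

/-- The binary world-lines are continuous. [folklore] -/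
lemma continuous_binaryCentre (i : Fin 2) : Continuous (binaryCentre i) := (contDiff_binaryCentre i).continuous

/-- The binary velocities are continuous. [folklore] -/
lemma continuous_binaryVel (i : Fin 2) : Continuous (binaryVel i) :=
  continuous_axisVel.add ((continuous_const.mul continuous_sepAD1).smul continuous_const)

/-- `binaryVel` is the velocity of `binaryCentre`. [folklore] -/
lemma hasDerivAt_binaryCentre (i : Fin 2) (t : ℝ) : HasDerivAt (binaryCentre i) (binaryVel i t) t :=
  (hasDerivAt_axisCentre t).add (((hasDerivAt_sepA t).const_mul _).smul_const axis1)

/-- `deriv (binaryCentre i) = binaryVel i`. [folklore] -/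
lemma deriv_binaryCentre (i : Fin 2) (t : ℝ) : deriv (binaryCentre i) t = binaryVel i t :=
  (hasDerivAt_binaryCentre i t).deriv

/-- Relative position of the binary. [folklore] -/
lemma binaryCentre_sub (i j : Fin 2) (t : ℝ) :
    binaryCentre i t - binaryCentre j t = ((((i : ℕ) : ℝ) - ((j : ℕ) : ℝ)) * sepA t) • axis1 := by
  simp only [binaryCentre]
  rw [add_sub_add_left_eq_sub, ← sub_smul]
  congr 1
  ring

/-- The separation of the binary is `d(t)`. [folklore] -/
lemma norm_binaryCentre_sub {i j : Fin 2} (hij : i ≠ j) (t : ℝ) : ‖binaryCentre i t - binaryCentre j t‖ = sepA t := by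
  have hs := sepA_pos t
  rw [binaryCentre_sub, norm_smul, norm_axis1, mul_one, Real.norm_eq_abs, abs_mul, abs_of_pos hs]
  fin_cases i <;> fin_cases j
  · exact absurd rfl hij
  · simp
  · simp
  · exact absurd rfl hij

/-- `‖axisVel t‖² = (vel t / 4)²`. [folklore] -/
lemma norm_axisVel_sq (t : ℝ) : ‖axisVel t‖ ^ 2 = (vel t / 4) ^ 2 := by
  rw [axisVel, norm_smul, norm_axis0, mul_one, Real.norm_eq_abs, sq_abs]
  ring

/-- `‖binaryVel i t‖² = (vel t / 4)² + d'(t)²/4`. [folklore] -/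
lemma norm_binaryVel_sq (i : Fin 2) (t : ℝ) : ‖binaryVel i t‖ ^ 2 = (vel t / 4) ^ 2 + sepAD1 t ^ 2 / 4 := by
  have : binaryVel i t = ((1 / 4 : ℝ) * vel t) • axis0 + ((((i : ℕ) : ℝ) - 1 / 2) * sepAD1 t) • axis1 := rfl
  rw [this, norm_sq_axis01]
  fin_cases i <;> simp <;> ring

/-- Speed bound `‖binaryVel i t‖ ≤ 1/2`. [folklore] -/
lemma norm_binaryVel_le (i : Fin 2) (t : ℝ) : ‖binaryVel i t‖ ≤ 1 / 2 := by
  have h1 := abs_vel_le t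
  have h2 := abs_sepAD1_le_half t
  have hsq : ‖binaryVel i t‖ ^ 2 ≤ (1 / 2) ^ 2 := by
    rw [norm_binaryVel_sq]
    have := abs_le.mp h1
    have := abs_le.mp h2
    nlinarith
  exact le_of_pow_le_pow_left₀ two_ne_zero (by norm_num) hsq

/-- `‖binaryVel i t‖² ≤ 1/8`. [folklore] -/
lemma norm_binaryVel_sq_le (i : Fin 2) (t : ℝ) : ‖binaryVel i t‖ ^ 2 ≤ 1 / 8 := by
  rw [norm_binaryVel_sq]
  have := abs_le.mp (abs_vel_le t)
  have := abs_le.mp (abs_sepAD1_le_half t)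
  nlinarith

/-- Coordinates of the velocities. [folklore] -/
lemma binaryVel_apply_zero (i : Fin 2) (t : ℝ) : binaryVel i t 0 = vel t / 4 := by
  simp [binaryVel, axisVel]; ring

/-- Coordinates of the velocities. [folklore] -/
lemma binaryVel_apply_one (i : Fin 2) (t : ℝ) : binaryVel i t 1 = (((i : ℕ) : ℝ) - 1 / 2) * sepAD1 t := by
  simp [binaryVel, axisVel]

/-- Coordinates of the velocities. [folklore] -/
lemma binaryVel_apply_two (i : Fin 2) (t : ℝ) : binaryVel i t 2 = 0 := by
  simp [binaryVel, axisVel]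

/-- Coordinates of the drift velocity. [folklore] -/
lemma axisVel_apply (t : ℝ) : axisVel t 0 = vel t / 4 ∧ axisVel t 1 = 0 ∧ axisVel t 2 = 0 := by
  refine ⟨?_, ?_, ?_⟩ <;> simp [axisVel] ; ring

/-- The drift coordinate of the binary is the scalar witness. [folklore] -/
lemma binaryCentre_apply_zero (i : Fin 2) (t : ℝ) : binaryCentre i t 0 = centre (1 / 4) t := by
  simp [binaryCentre, axisCentre]

/-- The binary is eventually inside the cone `(3/4)² t`. [folklore] -/
lemma eventually_norm_binaryCentre_le (i : Fin 2) : ∀ᶠ t in atTop, ‖binaryCentre i t‖ ≤ (3 / 4) ^ 2 * t := by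
  filter_upwards [eventually_norm_axisCentre_le, eventually_ge_atTop (4 : ℝ)] with t ht ht4
  have hs : sepA t ≤ 5 * t / 8 := by
    rw [sepA, Real.sqrt_le_iff]
    refine ⟨by positivity, ?_⟩
    have h2 := sepA_sq_le (by linarith : (0 : ℝ) ≤ t)
    rw [sepA_sq] at h2
    nlinarith
  have hc : ‖((((i : ℕ) : ℝ) - 1 / 2) * sepA t) • axis1‖ = sepA t / 2 := by
    rw [norm_smul, norm_axis1, mul_one, Real.norm_eq_abs, abs_mul, abs_of_pos (sepA_pos t)]
    fin_cases i <;> simp <;> ring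
  calc ‖binaryCentre i t‖ ≤ ‖axisCentre t‖ + ‖((((i : ℕ) : ℝ) - 1 / 2) * sepA t) • axis1‖ := norm_add_le _ _
    _ ≤ (1 / 2) ^ 2 * t + sepA t / 2 := by rw [hc]; gcongr
    _ ≤ (3 / 4) ^ 2 * t := by nlinarith

end Summit.FinalStateConjecture.FinalStateConjecture.Theorems.InertialRecession.Negative

end
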